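import Literature.InformationTheory.QuantumCodes.QuantumExpanderNoisySyndromeTheorem13Printed
import HarnessLib

/-!
# Small-set-flip with a NOISY syndrome (Fawzi–Grospellier–Leverrier, FOCS 2018), part 14: Theorem 13 with an existential noise threshold
# ("there exist constants `p₀ > 0` … such that if `p < p₀` then …") — PROOF

Index of sources: `[cite: FawziGrospellierLeverrier2018FT]` = Fawzi–Grospellier–Leverrier, FOCS 2018 / arXiv:1808.03821, Thm. 13 (p0016 L66-73: "There exist constants
`p₀ > 0`, `p₁ > 0` such that the following holds. Suppose the pair `(E, D)` satisfies a local stochastic noise model with parameter `(p_phys, p_synd)` where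
`p_phys < p₀` and `p_synd < p₁`. Then …").

Topic `Literature/InformationTheory/QuantumCodes` (venture QEC, row 04 `prover-qec-type-04` gen 8, line L-SSF-NOISY = PARTITION v2.48 D50.L8, node N25). Part 13
(`fgl18b_theorem13_printed`) carries two smallness hypotheses on the noise parameter `p` (`Δ_Q²·2^{max Δ}·p^{1/c₀} ≤ 1/2` and `2d'²·p^{α₀} < 1`); this file
packages them as ONE threshold `p₀ > 0` depending only on `(Δ_A, Δ_B, δ_A, δ_B, κ)` (not on the code size), in the printed quantifier order.

* `exists_noise_threshold` — `∃ p₀ > 0, ∀ p ∈ [0, p₀]`, both smallness hypotheses hold;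
* ★ `fgl18b_theorem13_exists` — Thm. 13 (our constants `K = 2^{1+max Δ}`, exponent `1/c₀`) with "`∃ p₀ > 0` … for all `p ≤ p₀`".

Column word: PROVED (kernel); no definitions, no named facts.
-/

namespace Literature.InformationTheory.QuantumCodes

open Finset Matrix Literature.Probability.LatticeModels

namespace QuantumExpander

variable {A B : Type*} [Fintype A] [Fintype B] [DecidableEq A] [DecidableEq B]

omit [Fintype A] [Fintype B] [DecidableEq A] [DecidableEq B] in
/-- **A noise threshold making both smallness hypotheses of `fgl18b_theorem13_printed` hold**: for `a, b > 0`, `c > 0`, `α > 0` there is `p₀ > 0` with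
`a·p^{1/c} ≤ 1/2` and `b·p^{α} < 1` for all `0 ≤ p ≤ p₀` (take `p₀ = min((1/(2a))^{c}, (1/(2b))^{1/α})`).
[cite: FawziGrospellierLeverrier2018FT, Thm 13 ("there exist constants p₀ > 0, p₁ > 0"; arXiv p0016 L66-69)] -/
theorem exists_noise_threshold {a b c α : ℝ} (ha : 0 < a) (hb : 0 < b) (hc : 0 < c) (hα : 0 < α) :
    ∃ p₀ : ℝ, 0 < p₀ ∧ ∀ p : ℝ, 0 ≤ p → p ≤ p₀ → a * p ^ (1 / c) ≤ 1 / 2 ∧ b * p ^ α < 1 := by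
  set u : ℝ := (1 / (2 * a)) ^ c with hu
  set v : ℝ := (1 / (2 * b)) ^ (1 / α) with hv
  have hu0 : 0 < u := Real.rpow_pos_of_pos (by positivity) _
  have hv0 : 0 < v := Real.rpow_pos_of_pos (by positivity) _
  refine ⟨min u v, lt_min hu0 hv0, fun p hp0 hp => ?_⟩
  constructor
  · -- `p^{1/c} ≤ u^{1/c} = 1/(2a)`
    have h1 : p ^ (1 / c) ≤ u ^ (1 / c) := Real.rpow_le_rpow hp0 (hp.trans (min_le_left _ _)) (by positivity)
    have h2 : u ^ (1 / c) = 1 / (2 * a) := by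
      rw [hu, ← Real.rpow_mul (by positivity), mul_one_div_cancel hc.ne', Real.rpow_one]
    rw [h2] at h1
    calc a * p ^ (1 / c) ≤ a * (1 / (2 * a)) := mul_le_mul_of_nonneg_left h1 ha.le
      _ = 1 / 2 := by field_simp
  · -- `p^{α} ≤ v^{α} = 1/(2b)`
    have h1 : p ^ α ≤ v ^ α := Real.rpow_le_rpow hp0 (hp.trans (min_le_right _ _)) hα.le
    have h2 : v ^ α = 1 / (2 * b) := by
      rw [hv, ← Real.rpow_mul (by positivity), one_div_mul_cancel hα.ne', Real.rpow_one]
    rw [h2] at h1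
    calc b * p ^ α ≤ b * (1 / (2 * b)) := mul_le_mul_of_nonneg_left h1 hb.le
      _ = 1 / 2 := by field_simp
      _ < 1 := by norm_num

open scoped Classical in
/-- ★ **FGL18b Theorem 13 with an existential threshold** (printed quantifier order; our constants): for `Q_G` and any tree small-set-flip decoder with threshold
`κ` (`0 < κ`, `2κ < min Δ·β₁`) there is `p₀ > 0` — depending only on `Δ_A, Δ_B, δ_A, δ_B, κ`, NOT on the code size — such that for every locally stochastic joint
law `μ` of parameter `p ≤ p₀` on `V ⊔ C_X` and every `t` with `max Δ·t ≤ min Δ·min(γ_A n_A, γ_B n_B)`, the three clauses of `fgl18b_theorem13_printed` hold: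
succᶜ `= HasAlphaCluster 𝒢 α₀ (t+1)` has weight `≤ |V⊔C_X|·r^{t+1}/(d'²(1−r))`, `E_ls ≡ E ⊕ Ê` on succ, and `E_ls` restricted to succ is locally stochastic with
parameter `2^{1+max Δ}·p^{1/c₀}`. [cite: FawziGrospellierLeverrier2018FT, Thm 13 (arXiv p0016 L66-73)] -/
theorem fgl18b_theorem13_exists (H : Matrix B A (ZMod 2)) {dA dB : ℕ} {γA δA γB δB : ℝ}
    (hreg : IsBiregular H dA dB) (hexp : IsLeftRightExpanding H dA dB γA δA γB δB)
    (hdA : 0 < dA) (hdB : 0 < dB) (hδA : 0 ≤ δA) (hδB : 0 ≤ δB)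
    {κ : ℝ} (hκ0 : 0 < κ) (hκ1 : 2 * κ < ((min dA dB : ℕ) : ℝ) * (1 - 16 * max δA δB))
    (Dec : Decoder (A × B → ZMod 2) ((A × A) ⊕ (B × B) → ZMod 2))
    (hDec : IsSSFDecoder κ (expanderHX H) (expanderHZ H) Dec) :
    ∃ p₀ : ℝ, 0 < p₀ ∧ ∀ (μ : Finset (((A × A) ⊕ (B × B)) ⊕ (A × B)) → ℝ) (p : ℝ),
      IsLocallyStochastic μ p → 0 ≤ p → p ≤ p₀ →
      ∀ t : ℕ, ((max dA dB : ℕ) : ℝ) * t ≤ ((min dA dB : ℕ) : ℝ) * min (γA * Fintype.card A) (γB * Fintype.card B) →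
      ∃ eLs : Finset (((A × A) ⊕ (B × B)) ⊕ (A × B)) → ((A × A) ⊕ (B × B) → ZMod 2),
        (∑ X ∈ univ.filter (fun X =>
            HasAlphaCluster (SmallSetFlip.syndromeAdjGraph (expanderHX H) (expanderHZ H))
              (κ / (2 * (κ + ((max dA dB : ℕ) : ℝ)))) (t + 1) X), μ X
          ≤ (Fintype.card (((A × A) ⊕ (B × B)) ⊕ (A × B)) : ℝ)
              * (2 * ((2 * max dA dB * (dA + dB - 1) + (dA + dB) : ℕ) : ℝ) ^ 2 * p ^ (κ / (2 * (κ + ((max dA dB : ℕ) : ℝ))))) ^ (t + 1)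
            / (((2 * max dA dB * (dA + dB - 1) + (dA + dB) : ℕ) : ℝ) ^ 2
              * (1 - 2 * ((2 * max dA dB * (dA + dB - 1) + (dA + dB) : ℕ) : ℝ) ^ 2 * p ^ (κ / (2 * (κ + ((max dA dB : ℕ) : ℝ))))))) ∧
        (∀ X, ¬ HasAlphaCluster (SmallSetFlip.syndromeAdjGraph (expanderHX H) (expanderHZ H))
            (κ / (2 * (κ + ((max dA dB : ℕ) : ℝ)))) (t + 1) X →
          eLs X + (flipVec (univ.filter fun q => Sum.inl q ∈ X)
            + Dec (expanderHX H *ᵥ flipVec (univ.filter fun q => Sum.inl q ∈ X)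
                + flipVec (univ.filter fun c => Sum.inr c ∈ X))) ∈ rowSpace (expanderHZ H)) ∧
        ∀ S : Finset ((A × A) ⊕ (B × B)),
          ∑ X ∈ univ.filter (fun X =>
              ¬ HasAlphaCluster (SmallSetFlip.syndromeAdjGraph (expanderHX H) (expanderHZ H))
                  (κ / (2 * (κ + ((max dA dB : ℕ) : ℝ)))) (t + 1) X ∧ S ⊆ supp (eLs X)), μ X
            ≤ (2 * ((2 : ℝ) ^ (max dA dB) * p ^ (1 / (4 / (((min dA dB : ℕ) : ℝ) * (1 - 16 * max δA δB) - 2 * κ)))))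
                ^ S.card := by
  -- the constants
  have hden : 0 < ((min dA dB : ℕ) : ℝ) * (1 - 16 * max δA δB) - 2 * κ := by linarith
  have hc0 : 0 < 4 / (((min dA dB : ℕ) : ℝ) * (1 - 16 * max δA δB) - 2 * κ) := div_pos (by norm_num) hden
  have hα0 : 0 < κ / (2 * (κ + ((max dA dB : ℕ) : ℝ))) := by positivity
  have hΔQ0 : (0 : ℝ) < ((2 * max dA dB * (dA + dB - 1) : ℕ) : ℝ) := by
    have h1 : 1 ≤ max dA dB := le_trans hdA (le_max_left _ _)
    have h2 : 1 ≤ dA + dB - 1 := by omega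
    have : 1 ≤ 2 * max dA dB * (dA + dB - 1) := by nlinarith
    exact_mod_cast this
  have hd0 : (0 : ℝ) < ((2 * max dA dB * (dA + dB - 1) + (dA + dB) : ℕ) : ℝ) := by
    have : 1 ≤ 2 * max dA dB * (dA + dB - 1) + (dA + dB) := by omega
    exact_mod_cast this
  -- with `a = Δ_Q²·2^{max Δ}`, `b = 2d'²`
  obtain ⟨p₀, hp₀, hthr⟩ := exists_noise_threshold
    (a := ((2 * max dA dB * (dA + dB - 1) : ℕ) : ℝ) ^ 2 * (2 : ℝ) ^ (max dA dB))
    (b := 2 * ((2 * max dA dB * (dA + dB - 1) + (dA + dB) : ℕ) : ℝ) ^ 2)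
    (by positivity) (by positivity) hc0 hα0
  refine ⟨p₀, hp₀, fun μ p hμ hp0 hpp₀ t ht => ?_⟩
  obtain ⟨hsm, hr⟩ := hthr p hp0 hpp₀
  have hsmall : ((2 * max dA dB * (dA + dB - 1) : ℕ) : ℝ) ^ 2
      * ((2 : ℝ) ^ (max dA dB) * p ^ (1 / (4 / (((min dA dB : ℕ) : ℝ) * (1 - 16 * max δA δB) - 2 * κ)))) ≤ 1 / 2 := by
    rw [← mul_assoc]; exact hsm
  have hp1 : p ≤ 1 := by
    -- from `b p^α < 1` with `b ≥ 2`: `p^α < 1/2 < 1`, hence `p < 1` (else `p^α ≥ 1`)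
    by_contra hgt
    push Not at hgt
    have h1 : (1 : ℝ) ≤ p ^ (κ / (2 * (κ + ((max dA dB : ℕ) : ℝ)))) := Real.one_le_rpow hgt.le hα0.le
    have hb2 : (2 : ℝ) ≤ 2 * ((2 * max dA dB * (dA + dB - 1) + (dA + dB) : ℕ) : ℝ) ^ 2 := by
      have : (1 : ℝ) ≤ ((2 * max dA dB * (dA + dB - 1) + (dA + dB) : ℕ) : ℝ) := by exact_mod_cast (show 1 ≤ _ by omega)
      nlinarith
    nlinarith
  exact fgl18b_theorem13_printed H hreg hexp hdA hdB hδA hδB hκ0 hκ1 Dec hDec hμ hp0 hp1 ht hsmall hr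

end QuantumExpander

end Literature.InformationTheory.QuantumCodes
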